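import Mathlib

/-! # Route CapacityClassicality — finite Katz expansions are classical
(stub for crux stmt-Langlands-8927, line Sketch)

The complex-analytic sub-case of the crux `EigenIntegralOverconvergentIsClassical`: a `q`-series
`g = Σ aₙ qⁿ` with radius of convergence `≥ 1` and a FINITE Katz expansion
`g = Σ_{i ≤ I} c_i · E_{p-1}^{-i}`, `c_i` the `q`-expansion of a classical form of weight
`k + i (p - 1)` on `Γ₁(N)`, is the `q`-expansion of a classical modular form of weight `k` on
`Γ₁(N)`.

Proof.  The `q`-series defines a holomorphic `1`-periodic function `g` on `ℍ` (radius `≥ 1`), and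
`g · E_{p-1}^I = Φ := Σ_{i ≤ I} F_i · E_{p-1}^{I-i}` is a modular form of weight `k + I (p - 1)` on
`Γ₁(N)` (injectivity of `q`-expansions).  Slashing by `γ ∈ Γ₁(N)` gives
`(g|γ - g) · E_{p-1}^I = 0`, so `g|γ = g` (holomorphic functions on `ℍ` have no zero divisors);
slashing by `γ ∈ SL₂(ℤ)` gives `g|γ · E_{p-1}^I = Φ|γ`, bounded at `i∞`, and `E_{p-1} → 1` there, so
`g` is bounded at every cusp.  Everything is Mathlib-level.
-/

set_option linter.dupNamespace false -- `Summit.Langlands.Langlands` is the mandated namespace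

noncomputable section

open UpperHalfPlane ModularForm Complex CongruenceSubgroup Filter Function
open scoped MatrixGroups Topology Manifold

namespace Summit.Langlands.Langlands.Theorems.CapacityClassicality

/-! ### Holomorphic `q`-series on `ℍ` -/

/-- A `q`-series `Σ aₙ qⁿ` with `‖aₙ‖ tⁿ` bounded for every `0 < t < 1` (radius of convergence
`≥ 1`) sums, at `q = e^{2πiτ}`, to a holomorphic function on `ℍ` whose extension to `ℂ` is
`1`-periodic. -/
private theorem exists_holomorphic_qSeries (a : ℕ → ℂ)
    (hrad : ∀ t : ℝ, 0 < t → t < 1 → ∃ C : ℝ, ∀ n, ‖a n‖ * t ^ n ≤ C) :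
    ∃ g : ℍ → ℂ, (∀ τ : ℍ, HasSum (fun n ↦ a n • Periodic.qParam 1 τ ^ n) (g τ)) ∧
      MDifferentiable 𝓘(ℂ) 𝓘(ℂ) g ∧ Periodic (g ∘ ofComplex) ((1 : ℝ) : ℂ) := by
  set P : FormalMultilinearSeries ℂ ℂ ℂ := .ofScalars ℂ a with hP
  have hrad1 : 1 ≤ P.radius := by
    refine le_of_forall_lt_imp_le_of_dense fun r hr ↦ ?_
    lift r to NNReal using hr.ne_top
    rcases eq_or_ne r 0 with rfl | hr0
    · simp
    obtain ⟨C, hC⟩ :=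
      hrad r (NNReal.coe_pos.mpr (pos_iff_ne_zero.mpr hr0)) (by exact_mod_cast hr)
    exact P.le_radius_of_bound C fun n ↦ by
      rw [hP, FormalMultilinearSeries.ofScalars_norm]
      exact hC n
  have hPs : HasFPowerSeriesOnBall P.sum P 0 1 :=
    (P.hasFPowerSeriesOnBall (zero_lt_one.trans_le hrad1)).mono zero_lt_one hrad1
  have hball : ∀ z : ℂ, 0 < z.im → Periodic.qParam 1 z ∈ Metric.eball (0 : ℂ) 1 := fun z hz ↦ by
    rw [← ENNReal.coe_one, Metric.eball_coe, NNReal.coe_one, mem_ball_zero_iff]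
    exact Periodic.norm_qParam_lt_one one_pos hz
  refine ⟨fun τ ↦ P.sum (Periodic.qParam 1 τ), fun τ ↦ ?_, ?_, fun w ↦ ?_⟩
  · simpa [hP, FormalMultilinearSeries.ofScalars_apply_eq, mul_comm] using
      hPs.hasSum (hball τ τ.im_pos)
  · refine UpperHalfPlane.mdifferentiable_iff.mpr <|
      DifferentiableOn.congr (f := fun z ↦ P.sum (Periodic.qParam 1 z)) (fun z hz ↦ ?_) ?_
    · exact ((hPs.analyticAt_of_mem (hball z hz)).differentiableAt.comp z
        (Periodic.differentiable_qParam z)).differentiableWithinAt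
    · intro z hz
      simp [ofComplex_apply_of_im_pos hz, coe_mk]
  · by_cases hw : 0 < w.im
    · have hw' : 0 < (w + (1 : ℝ)).im := by simpa using hw
      simp only [comp_apply, ofComplex_apply_of_im_pos hw', ofComplex_apply_of_im_pos hw, coe_mk]
      congr 1
      simp only [Periodic.qParam, ofReal_one, div_one, mul_add, mul_one, Complex.exp_add,
        Complex.exp_two_pi_mul_I]
    · have hw' : (w + (1 : ℝ)).im ≤ 0 := by simpa using hw
      simp only [comp_apply, ofComplex_apply_of_im_nonpos hw',
        ofComplex_apply_of_im_nonpos (not_lt.mp hw)]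

/-! ### Division by a form which is `1` at `i∞` -/

/-- If `f · u = ψ` on `ℍ`, where `ψ` is bounded at `i∞` and `u → 1` at `i∞`, then `f` is bounded
at `i∞`. -/
private theorem isBoundedAtImInfty_of_mul_eq {f u ψ : ℍ → ℂ} (hψ : IsBoundedAtImInfty ψ)
    (hu : Tendsto u atImInfty (𝓝 1)) (h : f * u = ψ) : IsBoundedAtImInfty f := by
  have hu' : Tendsto (fun τ ↦ (u τ)⁻¹) atImInfty (𝓝 1) := by simpa using hu.inv₀ one_ne_zero
  have hb : BoundedAtFilter atImInfty (ψ * fun τ ↦ (u τ)⁻¹) := hψ.mul (hu'.isBigO_one ℝ)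
  refine hb.congr' ?_ EventuallyEq.rfl
  filter_upwards [hu.eventually_ne one_ne_zero] with τ hτ
  simp only [Pi.mul_apply, ← h, mul_inv_cancel_right₀ hτ]

/-- **Division step.** Let `g` be holomorphic on `ℍ`, `Q` a level-one modular form of weight `m`
with `Q → 1` at `i∞`, and `Φ` a modular form of weight `k + m` on a finite-index subgroup `Γ` of
`SL₂(ℤ)` with `g · Q = Φ`.  Then `g` is a modular form of weight `k` on `Γ`: slash invariance holds
off the zero set of `Q`, hence everywhere, and at each cusp `g|γ = Φ|γ / Q` is bounded. -/
private theorem exists_modularForm_of_mul_eq {Γ : Subgroup SL(2, ℤ)} [Γ.FiniteIndex] {k m : ℤ}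
    {g : ℍ → ℂ} (hg : MDifferentiable 𝓘(ℂ) 𝓘(ℂ) g) (Q : ModularForm 𝒮ℒ m)
    (hQ1 : Tendsto (⇑Q) atImInfty (𝓝 1)) (Φ : ModularForm Γ (k + m)) (h : g * ⇑Q = ⇑Φ) :
    ∃ G : ModularForm Γ k, ⇑G = g := by
  -- `Q` is not identically zero
  have hQ0 : (⇑Q : ℍ → ℂ) ≠ 0 := by
    obtain ⟨τ, hτ⟩ := (hQ1.eventually_ne one_ne_zero).exists
    exact fun h0 ↦ hτ (congrFun h0 τ)
  -- slashing the identity `g · Q = Φ` by `γ ∈ SL(2, ℤ)`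
  have key : ∀ γ : SL(2, ℤ), (g ∣[k] γ) * ⇑Q = ⇑Φ ∣[k + m] γ := fun γ ↦ by
    have hQ : ⇑Q ∣[m] γ = ⇑Q := Q.slash_action_eq' _ ⟨γ, rfl⟩
    rw [← h, ModularForm.mul_slash_SL2, hQ]
  refine ⟨{ toFun := g
            slash_action_eq' := ?_
            holo' := hg
            bdd_at_cusps' := fun {c} hc ↦ ?_ }, rfl⟩
  · rintro _ ⟨γ, hγ, rfl⟩
    show g ∣[k] γ = g
    have hΦ : ⇑Φ ∣[k + m] γ = ⇑Φ := Φ.slash_action_eq' _ ⟨γ, hγ, rfl⟩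
    have h1 : (g ∣[k] γ - g) * ⇑Q = 0 := by
      rw [sub_mul, key, hΦ, ← h, sub_self]
    have hsl : MDifferentiable 𝓘(ℂ) 𝓘(ℂ) (g ∣[k] γ) :=
      hg.slash k (Matrix.SpecialLinearGroup.mapGL ℝ γ)
    exact sub_eq_zero.mp <| ((UpperHalfPlane.mul_eq_zero_iff (hsl.sub hg)
      (ModularFormClass.holo Q)).mp h1).resolve_right hQ0
  · rw [Subgroup.IsArithmetic.isCusp_iff_isCusp_SL2Z] at hc
    rw [OnePoint.isBoundedAt_iff_forall_SL2Z hc]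
    intro γ _
    exact isBoundedAtImInfty_of_mul_eq (ModularFormClass.bdd_at_infty_slash Φ γ) hQ1 (key γ)

/-! ### Level-one input: `E_{p-1}` -/

/-- A level-one modular form is a modular form on any subgroup `Γ` of `SL₂(ℤ)` (same function). -/
private theorem exists_restrict (Γ : Subgroup SL(2, ℤ)) {m : ℤ} (f : ModularForm 𝒮ℒ m) :
    ∃ f' : ModularForm Γ m, ⇑f' = ⇑f :=
  ⟨{ toFun := f
     slash_action_eq' := fun γ hγ ↦
       SlashInvariantForm.slash_action_eqn f γ (Subgroup.map_le_range _ _ hγ)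
     holo' := f.holo'
     bdd_at_cusps' := fun hc ↦ f.bdd_at_cusps' (hc.mono (Subgroup.map_le_range _ _)) }, rfl⟩

/-- The normalised level-one Eisenstein series `E_m` (`m ≥ 4` even) tends to its constant
`q`-coefficient `1` at `i∞`. -/
private theorem tendsto_E_atImInfty {m : ℕ} (hm : 3 ≤ m) (hm2 : Even m) :
    Tendsto (⇑(ModularForm.E hm)) atImInfty (𝓝 1) := by
  have han := ModularFormClass.analyticAt_cuspFunction_zero (ModularForm.E hm) one_pos
    one_mem_strictPeriods_SL
  have h0 : cuspFunction 1 (⇑(ModularForm.E hm)) 0 = 1 := by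
    simpa [qExpansion_coeff] using EisensteinSeries.E_qExpansion_coeff_zero hm hm2
  rw [← h0]
  exact (han.continuousAt.tendsto.comp (qParam_tendsto_atImInfty one_pos)).congr
    fun τ ↦ SlashInvariantFormClass.eq_cuspFunction (ModularForm.E hm) τ
      one_mem_strictPeriods_SL one_ne_zero

/-! ### The theorem -/

/-- **Finite Katz expansions are classical.** Let `p ≥ 5` be prime, `N ≥ 1`, `k ∈ ℤ`, and let
`g = Σ aₙ qⁿ` be a `q`-series with radius of convergence `≥ 1` admitting a finite Katz expansion
`Σ aₙ qⁿ = Σ_{i ≤ I} c_i · E_{p-1}^{-i}` in `ℂ⟦q⟧`, where `c_i` is the `q`-expansion of a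
modular form of weight `k + i (p - 1)` on `Γ₁(N)` and `E_{p-1}` is the normalised level-one
Eisenstein series.  Then `Σ aₙ qⁿ` is the `q`-expansion of a modular form of weight `k` on
`Γ₁(N)`. [folklore] -/
theorem finiteKatzExpansionClassical (p : ℕ) [Fact p.Prime] (hp : 5 ≤ p) (N : ℕ) [NeZero N]
    (k : ℤ) (a : ℕ → ℂ) (hrad : ∀ t : ℝ, 0 < t → t < 1 → ∃ C : ℝ, ∀ n, ‖a n‖ * t ^ n ≤ C)
    (I : ℕ) (c : ℕ → PowerSeries ℂ)
    (hc : ∀ i ∈ Finset.range (I + 1),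
      ∃ F : ModularForm (CongruenceSubgroup.Gamma1 N) (k + i * (p - 1 : ℕ)),
        c i = UpperHalfPlane.qExpansion 1 ⇑F)
    (hsum : PowerSeries.mk a = ∑ i ∈ Finset.range (I + 1),
      c i * ((UpperHalfPlane.qExpansion 1 ⇑(ModularForm.E (show 3 ≤ p - 1 by omega)))⁻¹) ^ i) :
    ∃ G : ModularForm (CongruenceSubgroup.Gamma1 N) k,
      UpperHalfPlane.qExpansion 1 ⇑G = PowerSeries.mk a := by
  have hp3 : 3 ≤ p - 1 := by omega
  have hev : Even (p - 1) := (Fact.out : p.Prime).even_sub_one (by omega)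
  -- the level-one form `E = E_{p-1}` and its `q`-expansion
  set E : ModularForm 𝒮ℒ ↑(p - 1) := ModularForm.E hp3 with hE
  set qE : PowerSeries ℂ := qExpansion 1 ⇑E with hqE
  have hqE0 : PowerSeries.constantCoeff qE ≠ 0 := by
    rw [← PowerSeries.coeff_zero_eq_constantCoeff_apply, hqE, hE,
      EisensteinSeries.E_qExpansion_coeff_zero hp3 hev]
    exact one_ne_zero
  have hΓ : (1 : ℝ) ∈ (Gamma1 N : Subgroup (GL (Fin 2) ℝ)).strictPeriods := by simp
  -- the holomorphic function `g` with `q`-expansion `Σ aₙ qⁿ`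
  obtain ⟨g, hgsum, hghol, hgper⟩ := exists_holomorphic_qSeries a hrad
  have hgbdd : IsBoundedAtImInfty g := isBoundedAtImInfty_of_hasSum_qExpansion one_pos hgsum
  have hgan : AnalyticAt ℂ (cuspFunction 1 g) 0 :=
    analyticAt_cuspFunction_zero one_pos hgper hghol hgbdd
  have hqg : qExpansion 1 g = PowerSeries.mk a := PowerSeries.ext fun n ↦ by
    rw [PowerSeries.coeff_mk]
    exact (qExpansion_coeff_unique (⟨g, hghol.continuous⟩ : C(ℍ, ℂ)) one_pos hgan hgsum n).symm
  -- the modular form `Φ = Σ_{i ≤ I} F_i · E^{I-i}` of weight `k + I (p - 1)` on `Γ₁(N)`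
  obtain ⟨E', hE'⟩ := exists_restrict (Gamma1 N) E
  choose F hF using hc
  have hw : ∀ i ∈ Finset.range (I + 1),
      k + (i : ℤ) * ((p - 1 : ℕ) : ℤ) + ((I - i : ℕ) : ℤ) * ((p - 1 : ℕ) : ℤ) =
        k + (I : ℤ) * ((p - 1 : ℕ) : ℤ) := fun i hi ↦ by
    rw [Nat.cast_sub (Nat.lt_succ_iff.mp (Finset.mem_range.mp hi))]
    ring
  set S : ℕ → ModularForm (Gamma1 N) (k + (I : ℤ) * ((p - 1 : ℕ) : ℤ)) := fun i ↦
    if hi : i ∈ Finset.range (I + 1) then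
      ModularForm.mcast (hw i hi) ((F i hi).mul (E'.pow (I - i))) else 0 with hS
  set Φ : ModularForm (Gamma1 N) (k + (I : ℤ) * ((p - 1 : ℕ) : ℤ)) :=
    ∑ i ∈ Finset.range (I + 1), S i with hΦ
  have hqS : ∀ i ∈ Finset.range (I + 1), qExpansion 1 ⇑(S i) = c i * qE ^ (I - i) := by
    intro i hi
    simp only [hS, dif_pos hi]
    rw [ModularForm.qExpansion_mcast, ModularForm.qExpansion_mul one_pos hΓ,
      ModularForm.qExpansion_pow one_pos hΓ, ← hF i hi, hE']
  have hqΦ : qExpansion 1 ⇑Φ = ∑ i ∈ Finset.range (I + 1), c i * qE ^ (I - i) := by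
    rw [← Finset.sum_congr rfl hqS]
    exact map_sum (ModularForm.qExpansionAddHom one_pos hΓ _) S _
  -- the Katz expansion, cleared of denominators: `(Σ aₙ qⁿ) · qE^I = Σ c_i · qE^{I-i}`
  have halg : PowerSeries.mk a * qE ^ I = ∑ i ∈ Finset.range (I + 1), c i * qE ^ (I - i) := by
    rw [hsum, Finset.sum_mul]
    refine Finset.sum_congr rfl fun i hi ↦ ?_
    have hi' : i ≤ I := Nat.lt_succ_iff.mp (Finset.mem_range.mp hi)
    have hpow : qE ^ I = qE ^ i * qE ^ (I - i) := by rw [← pow_add, Nat.add_sub_cancel' hi']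
    rw [mul_assoc, hpow, ← mul_assoc (qE⁻¹ ^ i), ← mul_pow, PowerSeries.inv_mul_cancel _ hqE0,
      one_pow, one_mul]
  -- hence `g · E^I = Φ` on `ℍ`, by injectivity of `q`-expansions
  have hEIan := ModularFormClass.analyticAt_cuspFunction_zero (E.pow I) one_pos
    one_mem_strictPeriods_SL
  have hΦan := ModularFormClass.analyticAt_cuspFunction_zero Φ one_pos hΓ
  have hq0 : qExpansion 1 (g * ⇑(E.pow I) - ⇑Φ) = 0 := by
    have hGan : AnalyticAt ℂ (cuspFunction 1 (g * ⇑(E.pow I))) 0 := by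
      rw [cuspFunction_mul hgan.continuousAt hEIan.continuousAt]
      exact hgan.mul hEIan
    rw [qExpansion_sub hGan hΦan, qExpansion_mul hgan hEIan, hqg,
      ModularForm.qExpansion_pow one_pos one_mem_strictPeriods_SL, halg, hqΦ, sub_self]
  have hident : g * ⇑(E.pow I) = ⇑Φ := by
    have hper : Periodic ((g * ⇑(E.pow I) - ⇑Φ) ∘ ofComplex) ((1 : ℝ) : ℂ) :=
      (hgper.mul (SlashInvariantFormClass.periodic_comp_ofComplex (E.pow I)
        one_mem_strictPeriods_SL)).sub (SlashInvariantFormClass.periodic_comp_ofComplex Φ hΓ)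
    have hhol := (hghol.mul (ModularFormClass.holo (E.pow I))).sub (ModularFormClass.holo Φ)
    have hbdd : IsBoundedAtImInfty (g * ⇑(E.pow I) - ⇑Φ) :=
      (hgbdd.mul (ModularFormClass.bdd_at_infty (E.pow I))).sub (ModularFormClass.bdd_at_infty Φ)
    exact sub_eq_zero.mp ((qExpansion_eq_zero_iff one_pos hper hhol hbdd).mp hq0)
  -- `E^I → 1` at `i∞`; divide
  have hE1 : Tendsto (⇑(E.pow I)) atImInfty (𝓝 1) := by
    have h := (tendsto_E_atImInfty hp3 hev).pow I
    rw [one_pow] at h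
    exact h.congr fun τ ↦ by simp [hE]
  obtain ⟨G, hG⟩ := exists_modularForm_of_mul_eq hghol (E.pow I) hE1 Φ hident
  exact ⟨G, by rw [hG, hqg]⟩

/-- **Finite Katz expansions are classical** (stub `stub_finiteKatzExpansionClassical` of crux
stmt-Langlands-8927, line Sketch): verbatim the registered signature, by
`finiteKatzExpansionClassical`. [folklore] -/
theorem stub_finiteKatzExpansionClassical (p : ℕ) [Fact p.Prime] (hp : 5 ≤ p) (N : ℕ) [NeZero N]
    (k : ℤ) (a : ℕ → ℂ) (hrad : ∀ t : ℝ, 0 < t → t < 1 → ∃ C : ℝ, ∀ n, ‖a n‖ * t ^ n ≤ C)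
    (I : ℕ) (c : ℕ → PowerSeries ℂ)
    (hc : ∀ i ∈ Finset.range (I + 1),
      ∃ F : ModularForm (CongruenceSubgroup.Gamma1 N) (k + i * (p - 1 : ℕ)),
        c i = UpperHalfPlane.qExpansion 1 ⇑F)
    (hsum : PowerSeries.mk a = ∑ i ∈ Finset.range (I + 1),
      c i * ((UpperHalfPlane.qExpansion 1 ⇑(ModularForm.E (show 3 ≤ p - 1 by omega)))⁻¹) ^ i) :
    ∃ G : ModularForm (CongruenceSubgroup.Gamma1 N) k,
      UpperHalfPlane.qExpansion 1 ⇑G = PowerSeries.mk a :=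
  finiteKatzExpansionClassical p hp N k a hrad I c hc hsum

end Summit.Langlands.Langlands.Theorems.CapacityClassicality

end
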